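import Mathlib
import HarnessLib

/-!
# The cone of a lift between projective resolutions resolves the cokernel (THEOREM A (1.2), infrastructure)

Crux `HomologicalConductor.Persistence` (stmt-ResolutionOfSingularities-16484), chain W4.4b — infrastructure
want **I-1 (α)** of CRUX-PLAN v12 §4.4 («cone-of-a-chain-map-as-resolution»), the first of the two pieces
FILE 2 of pool object U1 «THEOREM A in Lean» would need; source `L/res-L1-w44b-stub-3/THEOREM-A.md`
c2177413955d684d §1 (1.2) «`P• := Cone(T̃)` … the cone of a lift of an injective map with cokernel `M`
is a resolution of `M`». `[OURS · L1 w44b]` — folklore homological algebra, NOT a statement of the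
manuscript under review in cell res-hironaka and using none of its statements; AI-written, weaker than
expert review. Banked infrastructure (counted 0); FILE 2 itself stays STOPPED (res-L1-w44b-plan-1).

Setting: `0 → X₁ —f→ X₂ —g→ X₃ → 0` short exact in `ModuleCat R`, `P₁`, `P₂` projective resolutions
(Mathlib `ProjectiveResolution`), `φ : P₁.complex ⟶ P₂.complex` ANY chain map lifting `f`
(`hφ : φ ≫ P₂.π = P₁.π ≫ (single₀).map f`, e.g. `ProjectiveResolution.lift f P₁ P₂`),
`Cone(φ) := HomologicalComplex.homotopyCofiber φ` (degree `n+1`: `P₁.X n ⊞ P₂.X (n+1)`; degree `0`: `P₂.X 0`).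

* Element calculus of the cone in `ModuleCat` (`homotopyCofiber_decomp/₀`, `…_d_inlX_succ/_one`,
  `…_d_inrX`, `…_fstX_d`, `…_sndX_d`) — Mathlib's morphism identities evaluated on elements; they need
  `set_option backward.isDefEq.respectTransparency false` (`(homotopyCofiber φ).X n` vs
  `homotopyCofiber.X φ n` are only definitionally equal). `projective_homotopyCofiber_X`: `Cone(φ)` is
  degreewise projective.
* `homotopyCofiber_exactAt_succ_succ` (degrees `≥ 2`), `homotopyCofiber_exactAt_one` (degree `1`, uses
  that `f` is MONO: `f (π₁ x) = π₂ (φ x) = −π₂ (d y) = 0`), `homotopyCofiber_exact₀` (degree `0`, uses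
  exactness of `S` and that `π₁` is onto) — the three diagram chases.
* **`quasiIso_homotopyCofiber_desc`** — the map `Cone(φ) → single₀ X₃` induced by `P₂ → X₂ → X₃`
  (`homotopyCofiber.desc` with the zero null-homotopy of `φ ≫ (P₂ → X₂ → X₃) = 0`,
  `comp_π_comp_map_g_eq_zero`) is a quasi-isomorphism (`ChainComplex.quasiIsoAt₀_iff` +
  `ShortComplex.quasiIso_iff_of_zeros'` in degree `0`, `quasiIsoAt_iff_exactAt'` above);
  **`exists_projectiveResolution_cone`** — hence `ProjectiveResolution.mk (homotopyCofiber φ) …` is a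
  projective resolution of `X₃` whose complex is LITERALLY the cone, so Mathlib's
  `ProjectiveResolution.extMk` / `extMk_eq_zero_iff` / `mk₀_comp_extMk` compute `Ext(X₃, −)` by cone
  cocycles (THEOREM-A (1.2)–(1.3) with `X₁ = X₂ = R ⊗_A M`, `f = T`, `P₁ = P₂ = G•[u]` =
  `Functor.mapProjectiveResolution` of an `A`-resolution along the exact `extendScalars`, p518751).

* The cochain dictionary (want I-1 (β), first half): `homotopyCofiber_cocycle_iff` — a cochain
  `c : Cone(φ)_{m+1} → N` is a cocycle iff its components `f = c ∘ inr : G_{m+1} → N`,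
  `g = c ∘ inl : F_m → N` satisfy `f ∘ d = 0` and `f ∘ φ = g ∘ d` (THEOREM-A (1.2) «`(f, g)` is a cocycle
  ⟺ `f d_{m+1} = 0` and `f T̃_m = g d_m`»); `homotopyCofiber_inrX_inlX_desc` (every pair `(f, g)` is the
  pair of components of `snd ≫ f + fst ≫ g`); `homotopyCofiber_cochain_ext` (components determine the
  cochain).

Still missing for FILE 2 (want I-1 (β), second half): `E_m = Ext¹_A(Ω_{m−1}, N) = Hom(Ω_m, N)/ι^*` via
syzygy presentations, and the coboundary side through `ProjectiveResolution.extMk_eq_zero_iff`.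
-/

-- single-problem summit: the doubled namespace component is forced
set_option linter.dupNamespace false

noncomputable section

open CategoryTheory CategoryTheory.Limits HomologicalComplex

universe u

namespace Summit.ResolutionOfSingularities.ResolutionOfSingularities.Theorems.HomologicalConductor.PersistenceConeResolution

variable {R : Type u} [CommRing R]

section Elements

variable {F G : ChainComplex (ModuleCat.{u} R) ℕ} (φ : F ⟶ G)

set_option backward.isDefEq.respectTransparency false in
/-- Elements of the cone in positive degree decompose along `inlX`/`inrX`. [folklore] -/
theorem homotopyCofiber_decomp (n : ℕ) (z : (homotopyCofiber φ).X (n + 1)) :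
    z = homotopyCofiber.inlX φ n (n + 1) (by simp) (homotopyCofiber.fstX φ (n + 1) n (by simp) z) +
      homotopyCofiber.inrX φ (n + 1) (homotopyCofiber.sndX φ (n + 1) z) := by
  have hid : 𝟙 ((homotopyCofiber φ).X (n + 1)) =
      homotopyCofiber.fstX φ (n + 1) n (by simp) ≫ homotopyCofiber.inlX φ n (n + 1) (by simp) +
        homotopyCofiber.sndX φ (n + 1) ≫ homotopyCofiber.inrX φ (n + 1) := by
    apply homotopyCofiber.ext_to_X φ (n + 1) n (by simp)
    · simp [Preadditive.add_comp, homotopyCofiber.inlX_fstX, homotopyCofiber.inrX_fstX]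
    · simp [Preadditive.add_comp, homotopyCofiber.inlX_sndX, homotopyCofiber.inrX_sndX]
  have := ConcreteCategory.congr_hom hid z
  simp only [ModuleCat.hom_add, ModuleCat.hom_comp, LinearMap.add_apply, LinearMap.comp_apply, ModuleCat.hom_id, LinearMap.id_apply] at this
  exact this

set_option backward.isDefEq.respectTransparency false in
/-- Elements of the cone in degree `0` are `inrX` of their `sndX`. [folklore] -/
theorem homotopyCofiber_decomp₀ (z : (homotopyCofiber φ).X 0) :
    z = homotopyCofiber.inrX φ 0 (homotopyCofiber.sndX φ 0 z) := by
  have hid : homotopyCofiber.sndX φ 0 ≫ homotopyCofiber.inrX φ 0 = 𝟙 _ :=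
    homotopyCofiber.sndX_inrX φ 0 (by simp)
  have := ConcreteCategory.congr_hom hid z
  rw [ModuleCat.id_apply, ModuleCat.comp_apply] at this
  exact this.symm

set_option backward.isDefEq.respectTransparency false in
/-- `d (inl x) = −inl (d x) + inr (φ x)` in degrees `≥ 2`. [folklore] -/
theorem homotopyCofiber_d_inlX_succ (n : ℕ) (x : F.X (n + 1)) :
    (homotopyCofiber φ).d (n + 2) (n + 1) (homotopyCofiber.inlX φ (n + 1) (n + 2) (by simp) x) =
      -homotopyCofiber.inlX φ n (n + 1) (by simp) (F.d (n + 1) n x) +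
        homotopyCofiber.inrX φ (n + 1) (φ.f (n + 1) x) := by
  have h := homotopyCofiber.inlX_d φ (n + 2) (n + 1) n (by simp) (by simp)
  have := ConcreteCategory.congr_hom h x
  simp only [ModuleCat.hom_add, ModuleCat.hom_comp, ModuleCat.hom_neg, LinearMap.add_apply,
    LinearMap.comp_apply, LinearMap.neg_apply] at this
  exact this

set_option backward.isDefEq.respectTransparency false in
/-- `d (inl x) = inr (φ x)` from degree `1` to degree `0`. [folklore] -/
theorem homotopyCofiber_d_inlX_one (x : F.X 0) :
    (homotopyCofiber φ).d 1 0 (homotopyCofiber.inlX φ 0 1 (by simp) x) =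
      homotopyCofiber.inrX φ 0 (φ.f 0 x) := by
  have h := homotopyCofiber.inlX_d' φ 1 0 (by simp) (by simp)
  have := ConcreteCategory.congr_hom h x
  simp only [ModuleCat.hom_comp, LinearMap.comp_apply] at this
  exact this

set_option backward.isDefEq.respectTransparency false in
/-- `d (inr y) = inr (d y)`. [folklore] -/
theorem homotopyCofiber_d_inrX (i j : ℕ) (y : G.X i) :
    (homotopyCofiber φ).d i j (homotopyCofiber.inrX φ i y) =
      homotopyCofiber.inrX φ j (G.d i j y) := by
  have h := homotopyCofiber.inrX_d φ i j
  have := ConcreteCategory.congr_hom h y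
  simp only [ModuleCat.hom_comp, LinearMap.comp_apply] at this
  exact this

set_option backward.isDefEq.respectTransparency false in
/-- `fst (d z) = − d (fst z)` in degrees `≥ 2`. [folklore] -/
theorem homotopyCofiber_fstX_d (n : ℕ) (z : (homotopyCofiber φ).X (n + 2)) :
    homotopyCofiber.fstX φ (n + 1) n (by simp) ((homotopyCofiber φ).d (n + 2) (n + 1) z) =
      -F.d (n + 1) n (homotopyCofiber.fstX φ (n + 2) (n + 1) (by simp) z) := by
  have h := homotopyCofiber.d_fstX φ (n + 2) (n + 1) n (by simp) (by simp)
  have := ConcreteCategory.congr_hom h z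
  simp only [ModuleCat.hom_comp, ModuleCat.hom_neg, LinearMap.comp_apply, LinearMap.neg_apply]
    at this
  exact this

set_option backward.isDefEq.respectTransparency false in
/-- `snd (d z) = φ (fst z) + d (snd z)` in degrees `≥ 1`. [folklore] -/
theorem homotopyCofiber_sndX_d (n : ℕ) (z : (homotopyCofiber φ).X (n + 1)) :
    homotopyCofiber.sndX φ n ((homotopyCofiber φ).d (n + 1) n z) =
      φ.f n (homotopyCofiber.fstX φ (n + 1) n (by simp) z) +
        G.d (n + 1) n (homotopyCofiber.sndX φ (n + 1) z) := by
  have h := homotopyCofiber.d_sndX φ (n + 1) n (by simp)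
  have := ConcreteCategory.congr_hom h z
  simp only [ModuleCat.hom_add, ModuleCat.hom_comp, LinearMap.add_apply, LinearMap.comp_apply]
    at this
  exact this

end Elements

section Cone

variable {S : ShortComplex (ModuleCat.{u} R)} (hS : S.ShortExact)
  (P₁ : ProjectiveResolution S.X₁) (P₂ : ProjectiveResolution S.X₂)
  (φ : P₁.complex ⟶ P₂.complex)
  (hφ : φ ≫ P₂.π = P₁.π ≫ (ChainComplex.single₀ (ModuleCat.{u} R)).map S.f)

/-- The cone of a morphism of projective resolutions is degreewise projective. [folklore] -/
theorem projective_homotopyCofiber_X (n : ℕ) : Projective ((homotopyCofiber φ).X n) := by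
  cases n with
  | zero => exact Projective.of_iso (homotopyCofiber.XIso φ 0 (by simp)).symm inferInstance
  | succ n =>
    exact Projective.of_iso (homotopyCofiber.XIsoBiprod φ (n + 1) n (by simp)).symm inferInstance

include hφ in
/-- The lift `φ` followed by the augmentation of `P₂` and `g` vanishes (`g ∘ f = 0`). [folklore] -/
theorem comp_π_comp_map_g_eq_zero :
    φ ≫ (P₂.π ≫ (ChainComplex.single₀ (ModuleCat.{u} R)).map S.g) = 0 := by
  rw [← Category.assoc, hφ, Category.assoc, ← Functor.map_comp, S.zero, Functor.map_zero, comp_zero]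

/-! ### Element-level facts about the resolutions -/

/-- A cycle of positive degree in a projective resolution is a boundary. [folklore] -/
theorem exists_d_eq_of_d_eq_zero {Z : ModuleCat.{u} R} (P : ProjectiveResolution Z) (n : ℕ)
    (x : P.complex.X (n + 1)) (hx : P.complex.d (n + 1) n x = 0) :
    ∃ x' : P.complex.X (n + 2), P.complex.d (n + 2) (n + 1) x' = x :=
  (ShortComplex.moduleCat_exact_iff _).mp (P.exact_succ n) x hx

/-- An element of degree `0` killed by the augmentation is a boundary. [folklore] -/
theorem exists_d_eq_of_π_eq_zero {Z : ModuleCat.{u} R} (P : ProjectiveResolution Z)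
    (x : P.complex.X 0) (hx : P.π.f 0 x = 0) :
    ∃ x' : P.complex.X 1, P.complex.d 1 0 x' = x :=
  (ShortComplex.moduleCat_exact_iff _).mp P.exact₀ x hx

/-- The augmentation kills boundaries. [folklore] -/
theorem π_d_eq_zero {Z : ModuleCat.{u} R} (P : ProjectiveResolution Z) (y : P.complex.X 1) :
    P.π.f 0 (P.complex.d 1 0 y) = 0 := by
  have := ConcreteCategory.congr_hom P.complex_d_comp_π_f_zero y
  simp only [ModuleCat.hom_comp, LinearMap.comp_apply, ModuleCat.hom_zero, LinearMap.zero_apply] at this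
  exact this

/-- A chain map commutes with the differentials, on elements. [folklore] -/
theorem map_d_apply (i j : ℕ) (x : P₁.complex.X i) :
    φ.f j (P₁.complex.d i j x) = P₂.complex.d i j (φ.f i x) := by
  have := ConcreteCategory.congr_hom (φ.comm i j) x
  simp only [ModuleCat.hom_comp, LinearMap.comp_apply] at this
  exact this.symm

include hφ in
/-- Degree-`0` compatibility of the lift with the augmentations, on elements. [folklore] -/
theorem π_φ_apply (x : P₁.complex.X 0) : P₂.π.f 0 (φ.f 0 x) = S.f (P₁.π.f 0 x) := by
  have h := HomologicalComplex.congr_hom hφ 0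
  rw [HomologicalComplex.comp_f, HomologicalComplex.comp_f, ChainComplex.single₀_map_f_zero] at h
  have := ConcreteCategory.congr_hom h x
  simp only [ModuleCat.hom_comp, LinearMap.comp_apply] at this
  exact this

set_option backward.isDefEq.respectTransparency false in
/-- **The cone is exact in degrees `≥ 2`.** [folklore] -/
theorem homotopyCofiber_exactAt_succ_succ (n : ℕ) : (homotopyCofiber φ).ExactAt (n + 2) := by
  rw [HomologicalComplex.exactAt_iff' _ (n + 3) (n + 2) (n + 1) (by simp) (by simp),
    ShortComplex.moduleCat_exact_iff]
  intro z hz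
  change (homotopyCofiber φ).d (n + 2) (n + 1) z = 0 at hz
  change ∃ w, (homotopyCofiber φ).d (n + 3) (n + 2) w = z
  -- the `F`-component of `z` is a cycle, hence a boundary
  have hx : P₁.complex.d (n + 1) n (homotopyCofiber.fstX φ (n + 2) (n + 1) (by simp) z) = 0 := by
    have := homotopyCofiber_fstX_d φ n z
    rw [hz, map_zero] at this
    exact neg_eq_zero.mp this.symm
  obtain ⟨x', hx'⟩ := exists_d_eq_of_d_eq_zero P₁ n _ hx
  -- the `G`-component corrected by `φ x'` is a cycle, hence a boundary
  have hy : P₂.complex.d (n + 2) (n + 1)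
      (φ.f (n + 2) x' + homotopyCofiber.sndX φ (n + 2) z) = 0 := by
    have := homotopyCofiber_sndX_d φ (n + 1) z
    rw [hz, map_zero] at this
    rw [map_add, ← map_d_apply, hx']
    exact this.symm
  obtain ⟨y', hy'⟩ := exists_d_eq_of_d_eq_zero P₂ (n + 1) _ hy
  refine ⟨homotopyCofiber.inrX φ (n + 3) y' - homotopyCofiber.inlX φ (n + 2) (n + 3) (by simp) x', ?_⟩
  conv_rhs => rw [homotopyCofiber_decomp φ (n + 1) z]
  rw [map_sub, homotopyCofiber_d_inrX, homotopyCofiber_d_inlX_succ, hy', hx', map_add]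
  abel

set_option backward.isDefEq.respectTransparency false in
include hS hφ in
/-- **The cone is exact in degree `1`** (uses that `S.f` is a monomorphism). [folklore] -/
theorem homotopyCofiber_exactAt_one : (homotopyCofiber φ).ExactAt 1 := by
  rw [HomologicalComplex.exactAt_iff' _ 2 1 0 (by simp) (by simp), ShortComplex.moduleCat_exact_iff]
  intro z hz
  change (homotopyCofiber φ).d 1 0 z = 0 at hz
  change ∃ w, (homotopyCofiber φ).d 2 1 w = z
  have hinj : Function.Injective S.f := hS.moduleCat_injective_f
  -- the `F`-component `x` of `z` maps to `0` under `π₁` because `f (π₁ x) = π₂ (φ x) = -π₂ (d y) = 0`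
  have hsum : φ.f 0 (homotopyCofiber.fstX φ 1 0 (by simp) z) +
      P₂.complex.d 1 0 (homotopyCofiber.sndX φ 1 z) = 0 := by
    have := homotopyCofiber_sndX_d φ 0 z
    rw [hz, map_zero] at this
    exact this.symm
  have hx : P₁.π.f 0 (homotopyCofiber.fstX φ 1 0 (by simp) z) = 0 := by
    apply hinj
    rw [map_zero, ← π_φ_apply P₁ P₂ φ hφ, eq_neg_of_add_eq_zero_left hsum, map_neg, π_d_eq_zero,
      neg_zero]
  obtain ⟨x', hx'⟩ := exists_d_eq_of_π_eq_zero P₁ _ hx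
  have hy : P₂.complex.d 1 0 (φ.f 1 x' + homotopyCofiber.sndX φ 1 z) = 0 := by
    rw [map_add, ← map_d_apply, hx']
    exact hsum
  obtain ⟨y', hy'⟩ := exists_d_eq_of_d_eq_zero P₂ 0 _ hy
  refine ⟨homotopyCofiber.inrX φ 2 y' - homotopyCofiber.inlX φ 1 2 (by simp) x', ?_⟩
  conv_rhs => rw [homotopyCofiber_decomp φ 0 z]
  rw [map_sub, homotopyCofiber_d_inrX, homotopyCofiber_d_inlX_succ, hy', hx', map_add]
  abel

set_option backward.isDefEq.respectTransparency false in
include hS hφ in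
/-- **The cone is exact in degree `0` relative to the augmentation** `u ↦ g (π₂ (snd u))`: its kernel
is the image of `d : Cone₁ → Cone₀`. [folklore] -/
theorem homotopyCofiber_exact₀ (u : (homotopyCofiber φ).X 0)
    (hu : S.g (P₂.π.f 0 (homotopyCofiber.sndX φ 0 u)) = 0) :
    ∃ z : (homotopyCofiber φ).X 1, (homotopyCofiber φ).d 1 0 z = u := by
  -- `π₂ (snd u) ∈ ker g = im f = f (π₁ (P₁)₀)`
  obtain ⟨a, ha⟩ := (ShortComplex.moduleCat_exact_iff _).mp hS.exact _ hu
  obtain ⟨x, rfl⟩ := (ModuleCat.epi_iff_surjective (P₁.π.f 0)).mp inferInstance a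
  have hv : P₂.π.f 0 (homotopyCofiber.sndX φ 0 u - φ.f 0 x) = 0 := by
    rw [map_sub, π_φ_apply P₁ P₂ φ hφ, ha, sub_self]
  obtain ⟨y, hy⟩ := exists_d_eq_of_π_eq_zero P₂ _ hv
  refine ⟨homotopyCofiber.inlX φ 0 1 (by simp) x + homotopyCofiber.inrX φ 1 y, ?_⟩
  have hsum : homotopyCofiber.inrX φ 0 (φ.f 0 x) +
      homotopyCofiber.inrX φ 0 (homotopyCofiber.sndX φ 0 u - φ.f 0 x) = u := by
    have h := (map_add (homotopyCofiber.inrX φ 0).hom (φ.f 0 x)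
      (homotopyCofiber.sndX φ 0 u - φ.f 0 x)).symm
    rw [add_sub_cancel] at h
    exact h.trans (homotopyCofiber_decomp₀ φ u).symm
  rw [map_add, homotopyCofiber_d_inlX_one, homotopyCofiber_d_inrX, hy]
  exact hsum

set_option backward.isDefEq.respectTransparency false in
include hS hφ in
/-- **The augmentation of the cone is a quasi-isomorphism onto `X₃`**: for a short exact
`0 → X₁ → X₂ → X₃ → 0`, projective resolutions `P₁ → X₁`, `P₂ → X₂` and a lift `φ : P₁ → P₂` of
`X₁ → X₂`, the map `Cone(φ) → X₃` induced by `P₂ → X₂ → X₃` (and the zero null-homotopy of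
`φ ≫ (P₂ → X₂ → X₃) = 0`) is a quasi-isomorphism; with `projective_homotopyCofiber_X` this makes
`Cone(φ)` a projective resolution of `X₃` (`ProjectiveResolution.mk`). THEOREM-A (1.2)'s
«the cone of a lift of an injective map with cokernel `M` is a resolution of `M`». [folklore] -/
theorem quasiIso_homotopyCofiber_desc :
    QuasiIso (homotopyCofiber.desc φ (P₂.π ≫ (ChainComplex.single₀ (ModuleCat.{u} R)).map S.g)
      (Homotopy.ofEq (comp_π_comp_map_g_eq_zero P₁ P₂ φ hφ))) := by
  refine ⟨fun n => ?_⟩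
  rcases n with _ | _ | n
  · -- degree 0
    rw [ChainComplex.quasiIsoAt₀_iff, ShortComplex.quasiIso_iff_of_zeros' _ rfl rfl rfl]
    have hdesc : (homotopyCofiber.desc φ (P₂.π ≫ (ChainComplex.single₀ (ModuleCat.{u} R)).map S.g)
        (Homotopy.ofEq (comp_π_comp_map_g_eq_zero P₁ P₂ φ hφ))).f 0 =
          homotopyCofiber.sndX φ 0 ≫ P₂.π.f 0 ≫ S.g := by
      rw [homotopyCofiber.desc_f' φ _ _ 0 (by simp), HomologicalComplex.comp_f,
        ChainComplex.single₀_map_f_zero]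
    haveI : Epi (homotopyCofiber.sndX φ 0) := by
      haveI : Epi (homotopyCofiber.inrX φ 0 ≫ homotopyCofiber.sndX φ 0) := by
        rw [homotopyCofiber.inrX_sndX]; infer_instance
      exact epi_of_epi (homotopyCofiber.inrX φ 0) _
    haveI : Epi S.g := hS.epi_g
    constructor
    · rw [ShortComplex.moduleCat_exact_iff]
      intro u hu
      change (homotopyCofiber.desc φ (P₂.π ≫ (ChainComplex.single₀ (ModuleCat.{u} R)).map S.g)
        (Homotopy.ofEq (comp_π_comp_map_g_eq_zero P₁ P₂ φ hφ))).f 0 u = 0 at hu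
      change ∃ z, (homotopyCofiber φ).d 1 0 z = u
      rw [hdesc, ModuleCat.comp_apply, ModuleCat.comp_apply] at hu
      exact homotopyCofiber_exact₀ hS P₁ P₂ φ hφ u hu
    · change Epi ((homotopyCofiber.desc φ (P₂.π ≫ (ChainComplex.single₀ (ModuleCat.{u} R)).map S.g)
        (Homotopy.ofEq (comp_π_comp_map_g_eq_zero P₁ P₂ φ hφ))).f 0)
      rw [hdesc]
      infer_instance
  · -- degree 1
    rw [quasiIsoAt_iff_exactAt' _ _ (ChainComplex.exactAt_succ_single_obj _ _)]
    exact homotopyCofiber_exactAt_one hS P₁ P₂ φ hφ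
  · -- degree ≥ 2
    rw [quasiIsoAt_iff_exactAt' _ _ (ChainComplex.exactAt_succ_single_obj _ _)]
    exact homotopyCofiber_exactAt_succ_succ P₁ P₂ φ n

include hS hφ in
/-- **The cone is a projective resolution of `X₃`** (existence form; users needing the definitional
content write `ProjectiveResolution.mk (homotopyCofiber φ) …` inline, as in this proof). [folklore] -/
theorem exists_projectiveResolution_cone :
    ∃ P : ProjectiveResolution S.X₃, P.complex = homotopyCofiber φ := by
  haveI := quasiIso_homotopyCofiber_desc hS P₁ P₂ φ hφ
  exact ⟨{ complex := homotopyCofiber φ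
           projective := projective_homotopyCofiber_X P₁ P₂ φ
           π := homotopyCofiber.desc φ (P₂.π ≫ (ChainComplex.single₀ (ModuleCat.{u} R)).map S.g)
             (Homotopy.ofEq (comp_π_comp_map_g_eq_zero P₁ P₂ φ hφ)) }, rfl⟩

end Cone

/-! ## The cochain dictionary (THEOREM-A (1.2): «cochains are pairs `(f, g)`»; want I-1 (β), first half) -/

section Cochains

variable {F G : ChainComplex (ModuleCat.{u} R) ℕ} (φ : F ⟶ G) {N : ModuleCat.{u} R}

set_option backward.isDefEq.respectTransparency false in
/-- **Cocycles on the cone are pairs.** A cochain `c : Cone(φ)_{m+1} → N` is a cocycle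
(`c (d w) = 0` for all `w`) iff its components `f := c ∘ inr : G_{m+1} → N` and `g := c ∘ inl : F_m → N`
satisfy `f ∘ d = 0` and `f ∘ φ = g ∘ d` — THEOREM-A (1.2)'s «`(f, g)` is a cocycle ⟺ `f d_{m+1} = 0`
and `f T̃_m = g d_m`» (element form). [folklore] -/
theorem homotopyCofiber_cocycle_iff (m : ℕ) (c : (homotopyCofiber φ).X (m + 1) ⟶ N) :
    (∀ w, c ((homotopyCofiber φ).d (m + 2) (m + 1) w) = 0) ↔
      (∀ y, c (homotopyCofiber.inrX φ (m + 1) (G.d (m + 2) (m + 1) y)) = 0) ∧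
        ∀ x, c (homotopyCofiber.inrX φ (m + 1) (φ.f (m + 1) x)) =
          c (homotopyCofiber.inlX φ m (m + 1) (by simp) (F.d (m + 1) m x)) := by
  constructor
  · intro hw
    constructor
    · intro y
      have := hw (homotopyCofiber.inrX φ (m + 2) y)
      rw [homotopyCofiber_d_inrX] at this
      exact this
    · intro x
      have := hw (homotopyCofiber.inlX φ (m + 1) (m + 2) (by simp) x)
      rw [homotopyCofiber_d_inlX_succ, map_add, map_neg, neg_add_eq_zero] at this
      exact this.symm
  · rintro ⟨h₁, h₂⟩ w
    rw [homotopyCofiber_decomp φ (m + 1) w, map_add, homotopyCofiber_d_inlX_succ,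
      homotopyCofiber_d_inrX, map_add, map_add, map_neg, h₂, h₁, add_zero, neg_add_cancel]

set_option backward.isDefEq.respectTransparency false in
/-- **Every pair is a cochain**: the cochain with components `inr ≫ c = f`, `inl ≫ c = g` is
`snd ≫ f + fst ≫ g`. [folklore] -/
theorem homotopyCofiber_inrX_inlX_desc (m : ℕ) (f : G.X (m + 1) ⟶ N) (g : F.X m ⟶ N) :
    homotopyCofiber.inrX φ (m + 1) ≫
        (homotopyCofiber.sndX φ (m + 1) ≫ f + homotopyCofiber.fstX φ (m + 1) m (by simp) ≫ g) = f ∧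
      homotopyCofiber.inlX φ m (m + 1) (by simp) ≫
        (homotopyCofiber.sndX φ (m + 1) ≫ f + homotopyCofiber.fstX φ (m + 1) m (by simp) ≫ g) = g := by
  constructor
  · rw [Preadditive.comp_add, ← Category.assoc, ← Category.assoc, homotopyCofiber.inrX_sndX,
      homotopyCofiber.inrX_fstX, Category.id_comp, zero_comp, add_zero]
  · rw [Preadditive.comp_add, ← Category.assoc, ← Category.assoc, homotopyCofiber.inlX_sndX,
      homotopyCofiber.inlX_fstX, Category.id_comp, zero_comp, zero_add]

set_option backward.isDefEq.respectTransparency false in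
/-- Cochains on the cone are determined by their two components (element form). [folklore] -/
theorem homotopyCofiber_cochain_ext (m : ℕ) {c c' : (homotopyCofiber φ).X (m + 1) ⟶ N}
    (h₁ : ∀ y, c (homotopyCofiber.inrX φ (m + 1) y) = c' (homotopyCofiber.inrX φ (m + 1) y))
    (h₂ : ∀ x, c (homotopyCofiber.inlX φ m (m + 1) (by simp) x) =
      c' (homotopyCofiber.inlX φ m (m + 1) (by simp) x)) : c = c' := by
  ext w
  change c w = c' w
  rw [homotopyCofiber_decomp φ m w, map_add, map_add, h₁, h₂]

end Cochains

end Summit.ResolutionOfSingularities.ResolutionOfSingularities.Theorems.HomologicalConductor.PersistenceConeResolution
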